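import Literature.NumberTheory.LFunctions.AdditiveTwistArtin
import Literature.NumberTheory.GaloisRepresentations.ArtinDirichletTwistProofs
import Literature.NumberTheory.GaloisRepresentations.ArtinLFunctionRegularOffStripProofs
import Literature.NumberTheory.Automorphic.ArtinLFunctions
import HarnessLib

/-!
# Booker 2003, Lemma 1 from Artin's functional equation (pure proofs; companion to
`Literature.NumberTheory.LFunctions.AdditiveTwist`)

A. R. Booker, *Poles of Artin L-functions and the strong Artin conjecture*, Ann. of Math. 158
(2003), Lemma 1 (p. 1092): for an irreducible `ρ : Γ_ℚ → GL₂(ℂ)` with Dirichlet coefficients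
`aₙ` and rational `α`, the additive twist `L(s, ρ, α) = ∑ aₙ e(nα) n^{-s}` continues
meromorphically to `ℂ` with poles at most in the strip `0 < Re s < 1` — the named fact
`Literature.NumberTheory.LFunctions.Booker2003_lemma1`.  The printed proof (pp. 1092–1093) writes
`L(s, ρ, α)` as a finite combination `∑ᵢ cᵢ qᵢ^{-s} L(s, ρ ⊗ χᵢ)` of character twists
("`L(s, ρ, α) ∈ V`") and invokes, for each twist, holomorphy "in `Re(s) ≥ 1` by nonvanishing
results for Hecke L-functions, and by the functional equation, in `Re(s) ≤ 0`" (p. 1091).  The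
tree now holds every step of this argument as a theorem, except Artin's functional equation for
the twists, which is the named fact `Literature.NumberTheory.Automorphic.artin_functional_equation`
(Neukirch VII (12.6); not yet discharged at this pin).  This file assembles them:

* `exists_continuation_LSeries_mul_dirichlet_of_functionalEquation` — for irreducible
  `σ : Γ_ℚ → GL₂(ℂ)`, `a` with `∑ aₙ n^{-s} = L(s, σ)` on `Re s > 1`, and a Dirichlet character
  `χ` mod `M ≥ 1`: granting the functional equation of the irreducible two-dimensional
  `π : Γ_ℚ → GL₂(ℂ)` against their contragredients, the naive twist `∑ aₙ χ(n) n^{-s}` has a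
  continuation meromorphic on `ℂ` and analytic at every `s` with `Re s ≤ 0` or `Re s ≥ 1`.
  Proof: `∑ aₙ χ(n) n^{-s} = E(s) L(s, σ ⊗ χ)` with `E` entire
  (`GaloisRepresentations.FramedArtinRep.exists_differentiable_LSeries_mul_dirichlet_eq_mul_artinLFunction`,
  Booker p. 1093: "`L(s, ρ ⊗ χ₀ ⊗ χ)` with the Euler factor at `p` removed"), `σ ⊗ χ` is
  irreducible (`FramedRep.isIrreducible_of_twist`), and `L(s, σ ⊗ χ)` is regular off the strip
  (`FramedArtinRep.exists_meromorphicOn_eq_artinLFunction_analyticAt_off_strip_of_isIrreducible`: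
  Heilbronn on `Re s ≥ 1`, the functional equation on `Re s ≤ 0`);
* `Booker2003_lemma1_of_functionalEquation_two` — **Booker's Lemma 1 from the functional
  equation of the irreducible two-dimensional Artin representations of `ℚ`**
  (`Booker2003_lemma1_of_charTwist_continuation` of `AdditiveTwistArtin`, i.e. "`L(s, ρ, α) ∈ V`",
  fed with the previous theorem);
* `Booker2003_lemma1_of_artin_functional_equation` — the same from the named fact
  `Automorphic.artin_functional_equation (K := ℚ)`.

So `Booker2003_lemma1_holds` is the one-line application of the last theorem to
`artin_functional_equation_holds` once that fact is discharged; nothing else is missing.  (The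
evenness hypothesis of the named fact is the standing assumption of Booker's §"Proof for even
representations" and is not used by the proof of Lemma 1.)

No definition and no named fact is introduced (D-0026); theorems only.

## References

* A. R. Booker, *Poles of Artin L-functions and the strong Artin conjecture*, Ann. of Math. (2)
  158 (2003), 1089–1098: Lemma 1 p. 1092, its proof pp. 1092–1093, and p. 1091. [Booker2003]
* J. Neukirch, *Algebraic Number Theory* (1999), VII §12, Thm. (12.6). [NeukirchANT1999]
* H. Heilbronn, *Zeta-functions and L-functions*, Ch. VIII of Cassels–Fröhlich (1967), §3.
  [HeilbronnZetaL1967]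
-/

noncomputable section

open Complex Filter
open Literature.NumberTheory.GaloisRepresentations

namespace Literature.NumberTheory.LFunctions

/-- **Continuation of the naive character twists, given the functional equation** (Booker 2003,
proof of Lemma 1, p. 1092: "each `L(s, ρ ⊗ χ₀)` satisfies the conclusion of the lemma"; p. 1093:
the inner sums are "`L(s, ρ ⊗ χ₀ ⊗ χ)`, with the Euler factor at `p` removed"; p. 1091:
holomorphy in `Re(s) ≥ 1` and, "by the functional equation, in `Re(s) ≤ 0`").  Suppose every
irreducible `π : Γ_ℚ → GL₂(ℂ)` satisfies Artin's functional equation against its contragredient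
(`ArtinRep.SatisfiesFunctionalEquation`, Neukirch VII (12.6)).  Let `σ : Γ_ℚ → GL₂(ℂ)` be
irreducible, `a` any sequence with `∑ aₙ n^{-s} = L(s, σ)` on `Re s > 1`, and `χ` a Dirichlet
character mod `M ≥ 1`.  Then `∑ aₙ χ(n) n^{-s}` has a continuation `D` meromorphic on `ℂ` and
analytic at every `s` with `Re s ≤ 0` or `Re s ≥ 1`: `D = E · D_π` with `E` entire,
`∑ aₙ χ(n) n^{-s} = E(s) L(s, π)` for the twist `π = σ ⊗ χ` (`FramedRep.exists_twist`,
`FramedArtinRep.exists_differentiable_LSeries_mul_dirichlet_eq_mul_artinLFunction`), `π`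
irreducible (`FramedRep.isIrreducible_of_twist`), and `D_π` the continuation of `L(s, π)` regular
off the strip
(`FramedArtinRep.exists_meromorphicOn_eq_artinLFunction_analyticAt_off_strip_of_isIrreducible`).
[cite: Booker2003, proof of Lemma 1 pp. 1092–1093 and p. 1091] -/
theorem exists_continuation_LSeries_mul_dirichlet_of_functionalEquation
    (hFE : ∀ π : FramedArtinRep ℚ 2, π.toGaloisRep.IsIrreducible →
      π.toArtinRep.SatisfiesFunctionalEquation (FramedArtinRep.toArtinRep (FramedRep.dual π)))
    (σ : FramedArtinRep ℚ 2) (hirr : σ.toGaloisRep.IsIrreducible) {a : ℕ → ℂ}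
    (ha : ∀ s : ℂ, 1 < s.re → LSeries a s = artinLFunction σ.toArtinRep s)
    {M : ℕ} (χ : DirichletCharacter ℂ M) (hM : M ≠ 0) :
    ∃ D : ℂ → ℂ, MeromorphicOn D Set.univ ∧
      (∀ s : ℂ, s.re ≤ 0 ∨ 1 ≤ s.re → AnalyticAt ℂ D s) ∧
      ∀ s : ℂ, 1 < s.re → D s = LSeries (a * fun n : ℕ => χ (n : ZMod M)) s := by
  haveI : NeZero M := ⟨hM⟩
  obtain ⟨π, hπ⟩ := FramedRep.exists_twist σ (dirichletGaloisCharacter ℚ χ)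
  obtain ⟨E, hE, hEq⟩ :=
    FramedArtinRep.exists_differentiable_LSeries_mul_dirichlet_eq_mul_artinLFunction χ hπ ha
  have hirrπ := FramedRep.isIrreducible_of_twist hπ hirr
  obtain ⟨D, hDm, hDa, -, hDL⟩ :=
    FramedArtinRep.exists_meromorphicOn_eq_artinLFunction_analyticAt_off_strip_of_isIrreducible
      π one_lt_two hirrπ (hFE π hirrπ)
  refine ⟨fun s => E s * D s, fun z hz => (hE.analyticAt z).meromorphicAt.mul (hDm z hz),
    fun s hs => (hE.analyticAt s).mul (hDa s hs), fun s hs => ?_⟩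
  show E s * D s = _
  rw [hDL s hs, hEq s hs]

/-- **Booker 2003, Lemma 1, from the functional equation of the irreducible two-dimensional
Artin representations of `ℚ`.**  If every irreducible `π : Γ_ℚ → GL₂(ℂ)` satisfies Artin's
functional equation against its contragredient (`ArtinRep.SatisfiesFunctionalEquation`; Neukirch
VII (12.6)), then the named fact `Booker2003_lemma1` holds: "`L(s, ρ, α) ∈ V`"
(`Booker2003_lemma1_of_charTwist_continuation`, the algebraic half of the printed proof,
pp. 1092–1093) together with the continuation of the character twists
(`exists_continuation_LSeries_mul_dirichlet_of_functionalEquation`, the analytic half, p. 1091).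
[cite: Booker2003, Lemma 1 p. 1092 and its proof pp. 1092–1093] -/
theorem Booker2003_lemma1_of_functionalEquation_two
    (hFE : ∀ π : FramedArtinRep ℚ 2, π.toGaloisRep.IsIrreducible →
      π.toArtinRep.SatisfiesFunctionalEquation (FramedArtinRep.toArtinRep (FramedRep.dual π))) :
    Booker2003_lemma1 :=
  Booker2003_lemma1_of_charTwist_continuation fun σ _ hirr _ ha _ χ hM =>
    exists_continuation_LSeries_mul_dirichlet_of_functionalEquation hFE σ hirr ha χ hM

/-- **Booker 2003, Lemma 1, from Artin's functional equation over `ℚ`** (the named fact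
`Automorphic.artin_functional_equation (K := ℚ)`, Neukirch VII (12.6), of which only the case of
irreducible two-dimensional representations is used).  `Booker2003_lemma1_holds` is this theorem
applied to the discharge of that fact. [cite: Booker2003, Lemma 1 p. 1092]
[cite: NeukirchANT1999, VII §12, Thm. (12.6)] -/
theorem Booker2003_lemma1_of_artin_functional_equation
    (hFE : Automorphic.artin_functional_equation (K := ℚ)) : Booker2003_lemma1 :=
  Booker2003_lemma1_of_functionalEquation_two fun π _ => hFE π

end Literature.NumberTheory.LFunctions

end
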